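import Summits.BirchSwinnertonDyer.Rank1Residual.X11b.AnticyclotomicSelmerDual
import Literature.NumberTheory.EllipticCurves.IwasawaGeneratorChangeProofs
import Literature.NumberTheory.EllipticCurves.IwasawaEulerCharDualityProofs
import HarnessLib

/-!
# X11b, route R1 — `Sel^γ = Sel^{Γ_K}` and `(γ − 1)Sel = I_Γ · Sel`: the Euler-characteristic form of
# "`ord_p f_ac^Σ(0)`" is INTRINSIC to the `Γ_K`-module `Sel_𝔭^Σ(K_∞, E[p^∞])`

HONEST FRAMING (cell `b2b-bsdres`, run/shared/lean/b2b/bsd-rank1-residual/, verbatim in every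
file): the goal of the cell is to DELETE the COMBINATION-SHAPED residual classes of the
Birch–Swinnerton-Dyer formula for ALL analytic-rank `≤ 1` elliptic curves over `ℚ` — "full BSD
formula for every rank `≤ 1` curve in class `C`" assembled STRICTLY from published theorems — so
that the rank-`≤ 1` remainder becomes exactly the CONSTRUCTION-SHAPED classes, which are TYPED
(missing-input `Prop`s), NOT attempted. This is not "finishing BSD". Sub-cell
`b2b-bsdres-multr1-p1` (X11b, route R1 = Castella 2018 Thm. A re-proved along the author's
erratum); a RESEARCH ROUTE; no claim beyond the stated class; X11b stays CONSTRUCTION-SHAPED;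
nothing here changes a label; no named fact is minted (theorems only; no `sorry`).

## Content

`AnticyclotomicEulerChar.lean` proves that "`ord_p f_ac^Σ(0) = n`" for the constructed `Λ`-module
`X_ac^Σ(E[p^∞])` is equivalent to `#Sel^γ = p^n · #Sel_γ` with `Sel^γ = ker(conj_γ − 1)` and
`Sel_γ = Sel/(conj_γ − 1)Sel`, `Sel = Sel_𝔭^Σ(K_∞, E[p^∞])`. This file shows that these two groups do
not depend on the topological generator `γ` of `Gal(K_∞/K)` at all — they are the invariants and
the co-invariants of the whole group `Γ_K` acting on `Sel` by conjugation (an action factoring through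
`Γ = Γ_K/Gal(K̄/K_∞) ≅ ℤ_p`, in which the image of `γ` is topologically dense):

* **`mem_endInvariants_iff_forall_conj_eq`** — `s ∈ Sel^γ ↔ ∀ g ∈ Γ_K, conj_g s = s`
  (`H⁰(Γ, Sel) = Sel^{Γ_K}`): every `conj_g` agrees on each class with some power `conj_γ^m`
  (continuity of the action, `p`-adic approximation of `κ g ∈ ℤ_p` by `m ∈ ℕ`; tree
  `WeierstrassCurve.exists_conjH1_eq_conjH1_pow` for `κ γ = 1 ∈ ℤ_pˣ`).
* **`range_conjSelmerAc_sub_one_eq_closure`** — `(conj_γ − 1) Sel` is the augmentation submodule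
  `I_Γ · Sel := ⟨conj_g s − s : g ∈ Γ_K, s ∈ Sel⟩` (`H¹(Γ, Sel) ≅ Sel_Γ = Sel/I_Γ Sel`):
  `conj_g s − s = conj_γ^m s − s = (conj_γ − 1)(∑_{i<m} conj_γ^i s)` (`mul_geom_sum`).

Hence the right-hand side of `XAc.hasCharValuationAt_iff_card` reads
`#Sel^{Γ_K} = p^n · #(Sel / I_Γ Sel)`, a statement about the discrete `Γ_K`-module
`Sel_𝔭^Σ(K_∞, E[p^∞])` alone (it depends on `κ` only through `ker κ = Gal(K̄/K_∞)`, and not on `γ`).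

References: [GreenbergLNM1716] §1 p. 60, §4 (Remark after Lemma 4.2, p. 102: `|S^Γ|/|S_Γ|` as the
Euler characteristic `|H⁰(Γ,S)|/|H¹(Γ,S)|`); [CoatesSchneiderSujatha2003] §3 (30)–(31);
[Washington1997] §13.2 (Thm. 7.1 ff., `ℤ_p⟦Γ⟧ ≅ ℤ_p⟦T⟧`, `γ ↦ 1 + T`); [SerreGaloisCohomology1997]
I.§2.6 (b).
-/

noncomputable section

open scoped Classical

open NumberField IsDedekindDomain Field
open Literature.NumberTheory.EllipticCurves Literature.NumberTheory.EllipticCurves.GreenbergSelmer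
open Literature.NumberTheory.GaloisRepresentations

universe u

namespace Summit.BirchSwinnertonDyer.Rank1Residual.X11b.AcSelmer

variable {K : Type u} [Field K] [NumberField K] (W : WeierstrassCurve K) (p : ℕ) [Fact p.Prime]
  (κ : ZpExtension K p) (𝔭 : HeightOneSpectrum (𝓞 K)) (S : Set (HeightOneSpectrum (𝓞 K)))
  (γ : absoluteGaloisGroup K) [hγ : Fact (κ.IsTopGenerator γ)]

/-- For a topological generator `γ`, **every `conj_g`, `g ∈ Γ_K`, agrees on each class of
`Sel_𝔭^Σ(K_∞, E[p^∞])` with a power `conj_γ^m`** (`m` depending on the class): continuity of the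
`Γ_K`-action and `p`-adic approximation (tree `exists_conjH1_eq_conjH1_pow`, `κ γ = 1 ∈ ℤ_pˣ`).
[cite: SerreGaloisCohomology1997, I.§2.6 (b)] [cite: Washington1997, §13.2] -/
theorem exists_conjSelmerAc_eq_pow_apply (g : absoluteGaloisGroup K) (s : selmerAc W p κ 𝔭 S) :
    ∃ m : ℕ, conjSelmerAc W p κ 𝔭 S g s = ((conjSelmerAc W p κ 𝔭 S γ) ^ m) s := by
  obtain ⟨m, hm⟩ := W.exists_conjH1_eq_conjH1_pow κ (u₁ := 1) hγ.out isUnit_one g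
    (s : W.subgroupH1 p κ.kerSubgroup)
  exact ⟨m, Subtype.ext (by rw [coe_conjSelmerAc_apply, coe_conjSelmerAc_pow_apply]; exact hm)⟩

omit hγ in
/-- A class fixed by `conj_γ` is fixed by every power `conj_γ^m`. [folklore] -/
theorem conjSelmerAc_pow_apply_eq_self_of_eq {s : selmerAc W p κ 𝔭 S}
    (h : conjSelmerAc W p κ 𝔭 S γ s = s) (m : ℕ) : ((conjSelmerAc W p κ 𝔭 S γ) ^ m) s = s := by
  induction m with
  | zero => rw [pow_zero, AddMonoid.End.one_apply]
  | succ m ih => rw [pow_succ, AddMonoid.End.coe_mul, Function.comp_apply, h, ih]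

/-- **`Sel^γ = Sel^{Γ_K}`** (`H⁰(Γ, Sel)` is intrinsic): a class of `Sel_𝔭^Σ(K_∞, E[p^∞])` is fixed by
`conj_γ` for the topological generator `γ` iff it is fixed by `conj_g` for EVERY `g ∈ Γ_K`. In
particular the subgroup `IwasawaDual.endInvariants (conj_γ − 1)` appearing in
`XAc.hasCharValuationAt_iff_card` does not depend on `γ`.
[cite: GreenbergLNM1716, §4, Remark after Lemma 4.2 (p. 102)] [cite: CoatesSchneiderSujatha2003, §3 (30)] -/
theorem mem_endInvariants_iff_forall_conj_eq (s : selmerAc W p κ 𝔭 S) :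
    s ∈ IwasawaDual.endInvariants (conjSelmerAc W p κ 𝔭 S γ - 1) ↔
      ∀ g : absoluteGaloisGroup K, conjSelmerAc W p κ 𝔭 S g s = s := by
  rw [IwasawaDual.mem_endInvariants_iff, IwasawaDual.End_sub_apply, AddMonoid.End.one_apply,
    sub_eq_zero]
  refine ⟨fun h g ↦ ?_, fun h ↦ h γ⟩
  obtain ⟨m, hm⟩ := exists_conjSelmerAc_eq_pow_apply W p κ 𝔭 S γ g s
  rw [hm, conjSelmerAc_pow_apply_eq_self_of_eq W p κ 𝔭 S γ h m]

/-- **`(conj_γ − 1) Sel = I_Γ · Sel`** (`H¹(Γ, Sel) ≅ Sel_Γ` is intrinsic): the image of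
`conj_γ − 1` on `Sel_𝔭^Σ(K_∞, E[p^∞])` is the augmentation subgroup generated by all `conj_g s − s`,
`g ∈ Γ_K`, `s ∈ Sel`: `⊆` is clear, and `conj_g s − s = conj_γ^m s − s = (conj_γ − 1)(∑_{i<m} conj_γ^i s)`
(`mul_geom_sum` in the ring `End(Sel)`). In particular the quotient
`IwasawaDual.EndCoinvariants (conj_γ − 1) = Sel/(conj_γ − 1)Sel` of `XAc.hasCharValuationAt_iff_card`
does not depend on `γ`. [cite: GreenbergLNM1716, §4, Remark after Lemma 4.2 (p. 102)] [cite: CoatesSchneiderSujatha2003, §3 (30)] -/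
theorem range_conjSelmerAc_sub_one_eq_closure :
    (AddMonoidHomClass.toAddMonoidHom (conjSelmerAc W p κ 𝔭 S γ - 1)).range =
      AddSubgroup.closure {t : selmerAc W p κ 𝔭 S |
        ∃ (g : absoluteGaloisGroup K) (s : selmerAc W p κ 𝔭 S), t = conjSelmerAc W p κ 𝔭 S g s - s} := by
  apply le_antisymm
  · rintro t ⟨s, rfl⟩
    refine AddSubgroup.subset_closure ⟨γ, s, ?_⟩
    rw [AddMonoidHom.coe_coe, IwasawaDual.End_sub_apply, AddMonoid.End.one_apply]
  · rw [AddSubgroup.closure_le]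
    rintro t ⟨g, s, rfl⟩
    obtain ⟨m, hm⟩ := exists_conjSelmerAc_eq_pow_apply W p κ 𝔭 S γ g s
    refine ⟨(∑ i ∈ Finset.range m, (conjSelmerAc W p κ 𝔭 S γ) ^ i) s, ?_⟩
    rw [AddMonoidHom.coe_coe, hm]
    calc (conjSelmerAc W p κ 𝔭 S γ - 1) ((∑ i ∈ Finset.range m, (conjSelmerAc W p κ 𝔭 S γ) ^ i) s)
        = ((conjSelmerAc W p κ 𝔭 S γ - 1) * ∑ i ∈ Finset.range m, (conjSelmerAc W p κ 𝔭 S γ) ^ i)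
            s := by
          rw [AddMonoid.End.coe_mul, Function.comp_apply]
      _ = ((conjSelmerAc W p κ 𝔭 S γ) ^ m - 1) s := by rw [mul_geom_sum]
      _ = ((conjSelmerAc W p κ 𝔭 S γ) ^ m) s - s := by
          rw [IwasawaDual.End_sub_apply, AddMonoid.End.one_apply]

/-- **The `Γ_K`-invariants as a set do not depend on `γ`**: for two topological generators (indeed for
any `γ'` at all on the right) `Sel^{γ} ⊆ Sel^{γ'}`; with the roles exchanged, equality.
[cite: GreenbergLNM1716, §4, Remark after Lemma 4.2 (p. 102)] -/
theorem endInvariants_le_endInvariants (γ' : absoluteGaloisGroup K) :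
    IwasawaDual.endInvariants (conjSelmerAc W p κ 𝔭 S γ - 1) ≤
      IwasawaDual.endInvariants (conjSelmerAc W p κ 𝔭 S γ' - 1) := by
  intro s hs
  rw [IwasawaDual.mem_endInvariants_iff, IwasawaDual.End_sub_apply, AddMonoid.End.one_apply,
    sub_eq_zero]
  exact (mem_endInvariants_iff_forall_conj_eq W p κ 𝔭 S γ s).mp hs γ'

/-- **The image `(conj_{γ'} − 1) Sel` lies in `(conj_γ − 1) Sel`** for the topological generator `γ`
and ANY `γ' ∈ Γ_K` (so the co-invariants do not depend on the generator either).
[cite: GreenbergLNM1716, §4, Remark after Lemma 4.2 (p. 102)] -/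
theorem range_sub_one_le_range (γ' : absoluteGaloisGroup K) :
    (AddMonoidHomClass.toAddMonoidHom (conjSelmerAc W p κ 𝔭 S γ' - 1)).range ≤
      (AddMonoidHomClass.toAddMonoidHom (conjSelmerAc W p κ 𝔭 S γ - 1)).range := by
  rw [range_conjSelmerAc_sub_one_eq_closure W p κ 𝔭 S γ]
  rintro t ⟨s, rfl⟩
  refine AddSubgroup.subset_closure ⟨γ', s, ?_⟩
  rw [AddMonoidHom.coe_coe, IwasawaDual.End_sub_apply, AddMonoid.End.one_apply]

end Summit.BirchSwinnertonDyer.Rank1Residual.X11b.AcSelmer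

end
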